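import Summits.QuantumFields.YangMills.Theorems.F4SubCurvatureDoorShortRootRigidityOddModeAnalyticHalfUnfolded
import Summits.QuantumFields.YangMills.Theorems.F4SubCurvatureDoorShortRootRigidityOddModeSplitRegistered
import Mathlib
import HarnessLib

/-!
# OddModeRigidity — R-O1 «ANALYTIC HALF» BY NAME: `analyticHalf_holds : AnalyticHalf`

Crux ⟨stmt-QuantumFields-23035⟩ `F4SubCurvatureDoor.ShortRootRigidity`, registered stub `:146 stub_oddModeRigidity`, typed three-way split
`Cruxes/ShortRootRigidity/Lines/odd_mode_split.lean` (ym-idea-3 g21/g22; critic idea-crit-4 g10 PASS by hash):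
`OddModeRigidity ⇐ AnalyticHalf ∧ TorusReduction ∧ TrigonalInjectivityAll`, importable vocabulary ✓p729610
`…ShortRootRigidityOddModeSplitRegistered` (w3 g38; `OddModeRigidity`, `pev`, `NoBadModes`, `AnalyticHalf`, … character-identical).

PROVED here over that vocabulary (pure proof file, no definitions):
* `analyticHalf_holds : AnalyticHalf` := ✓`isometry_invariant_of_noBadModes` (`pev = toFun`, `Σ∂ᵢ∂ᵢ = lap` definitionally; only
  conjuncts 1 (continuity off `0`) and 3 (signed-permutation invariance) of `InClass` are used — no analyticity, budget or RP);
* `oddModeRigidity_of_noBadModesF4` — the same door with the FULL class symmetry passed down: it suffices to exclude bad modes among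
  harmonics invariant under the signed permutations AND the `D₄`-preserving isometries (conjunct 6 of `InClass`), should the planners
  prefer the weaker polynomial statement (cf. the typed-falsifier checks: no bad modes for even `L ≤ 16` already with `W(B₄)` alone,
  job:j333276; w3 g38 independently `L ≤ 18`).

Mathlib + tree only; no `sorry`; standard axioms.  HONEST LABEL: ONE of the three pieces of the split of the OPEN stub `:146`
(`TrigonalInjectivityAll` is w3 g38's ⧗/✓ chain; `TorusReduction` is OPEN and untyped beyond the Prop); `OddModeRigidity`, ⟨23035⟩,
⟨23125⟩ (S1), R2d and the Yang–Mills mass gap remain OPEN; no summit is proved by a line.  Seat `ym-line-frs-p2` g16 (cell ym-idea-3, free hands).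
-/

noncomputable section

namespace Summit.QuantumFields.YangMills.Theorems.F4SubCurvatureDoorOddModeSplitRegistered

open scoped BigOperators
open MvPolynomial
open Literature.MathematicalPhysics.QuantumLattice (siteToE)
open Summit.QuantumFields.YangMills.Cruxes.OSLegsAtWeakCouplingC.Sketch (IsSignedPerm)
open Summit.QuantumFields.YangMills.Theorems.F4SubCurvatureDoorMirrorAnalyticityRegistered (E4 InClass)
open Summit.QuantumFields.YangMills.Theorems.F4SubCurvatureDoorSliceDensityRegistered (EvenPartSliceInvariant)
open Summit.QuantumFields.YangMills.Theorems.F4SubCurvatureDoorAnalyticHalfProof (isometry_invariant_of_noBadModes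
  isometry_invariant_of_noBadModes_F4)

/-- **R-O1 «ANALYTIC HALF» BY NAME: `AnalyticHalf` holds** — if no degree has bad modes, every class kernel with slice-invariant even
part is `O(4)`-invariant. -/
theorem analyticHalf_holds : AnalyticHalf := by
  intro hNB K hK hE R x
  exact isometry_invariant_of_noBadModes (fun L h hh hl hs he => hNB L h hh hl hs he) hK.1 hK.2.2.1 hE R x

/-- **The `F₄` door.**  `OddModeRigidity` already follows if bad modes are excluded among the harmonic homogeneous polynomials invariant
under the signed permutations AND under the isometries preserving the checkerboard lattice `D₄` (a weaker polynomial statement than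
`∀ L, NoBadModes L`). -/
theorem oddModeRigidity_of_noBadModesF4
    (hNB : ∀ (L : ℕ) (h : MvPolynomial (Fin 4) ℝ), h.IsHomogeneous L → (∑ i, pderiv i (pderiv i h) = 0) →
      (∀ R : E4 ≃ₗᵢ[ℝ] E4, IsSignedPerm R → ∀ x : E4, pev h (R x) = pev h x) →
      (∀ R : E4 ≃ₗᵢ[ℝ] E4,
        (∀ z : Fin 4 → ℤ, Even (∑ i, z i) → ∃ w : Fin 4 → ℤ, Even (∑ i, w i) ∧ R (siteToE z) = siteToE w) →
        ∀ x : E4, pev h (R x) = pev h x) →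
      EvenPartSliceInvariant (pev h) → ∀ (R : E4 ≃ₗᵢ[ℝ] E4) (x : E4), pev h (R x) = pev h x) :
    OddModeRigidity := by
  intro K hK hE R x
  exact isometry_invariant_of_noBadModes_F4 (fun L h hh hl hs hd he => hNB L h hh hl hs hd he) hK.1 hK.2.2.1 hK.2.2.2.2.2 hE R x

end Summit.QuantumFields.YangMills.Theorems.F4SubCurvatureDoorOddModeSplitRegistered

end
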